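import Summits.CriticalPhenomena.PercolationContinuityZ3.Theorems.Transplant.FKThreeApexAlgebra
import Summits.CriticalPhenomena.PercolationContinuityZ3.Theorems.Transplant.FKThreeApexClusterCount
import HarnessLib

/-!
# Connectivity correlation inequalities for `φ_{w,q}` — the three-apex family: RIGID EVALUATION of the letter product

Support file (`--supports stmt-CriticalPhenomena-4575`), FK sub-lane `prim-bschramm-fk-3` (gen 12); builds on p205010 (kernel theorem, internal audit
signed; external expert review pending).  Pure algebra; no named facts, no sorries; standard axioms.  Layer 2b-i of the `K_{1,1,1,n}` programme
(memo `bschramm/prim-bschramm-fk-3/THREE-APEX.md` §6): the deterministic half of the rigid-interpolation bridge.  For ATTACHMENT PATTERNS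
`att i = (x, y, z)` (Booleans) the leaf letters `leaf q x y z` (with `x, y, z ∈ {0, 1}`) act on the basis vectors `e_π` (`π ∈ P3`) of `V5` by
`M(leaf) e_π = q^{[leaf unattached]} · e_{π.attach x y z}` (**`conv_leafB_basis`**), so the product over the first `i` leaves applied to `e_{π₀}` is
`q^{#unattached} · e_{π_i}` (**`zvecB_eq`**) and its `q^{|·|}`-valuation is `q^{blocks π_i + #unattached}` (**`val_zvecB`**) — by `conf_inv`
(`…ClusterCount`) this is `q^{k(conf i)}`, the random-cluster weight of the rigid configuration (assembled with the measure in layer 2b-ii).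
[cite: Grimmett2006, §1.4 eq. (1.20) (p. 15)] [folklore]
-/

noncomputable section

namespace Summit.CriticalPhenomena.PercolationContinuityZ3.Theorems

namespace FK

namespace ThreeApex

/-- Scalar multiple of a five-vector. [folklore] -/
def V5.smul (r : ℝ) (Z : V5) : V5 := ⟨r * Z.z0, r * Z.zab, r * Z.zac, r * Z.zbc, r * Z.z1⟩

/-- The basis vector of an apex partition. [folklore] -/
def basisVec : P3 → V5
  | .bot => ⟨1, 0, 0, 0, 0⟩
  | .ab => ⟨0, 1, 0, 0, 0⟩
  | .ac => ⟨0, 0, 1, 0, 0⟩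
  | .bc => ⟨0, 0, 0, 1, 0⟩
  | .top => ⟨0, 0, 0, 0, 1⟩

/-- `δ_0` is the basis vector of `bot`. [folklore] -/
theorem delta0_eq_basisVec : delta0 = basisVec .bot := rfl

/-- The `q^{|π|}`-valuation `q³Z_0 + q²(Z_ab+Z_ac+Z_bc) + qZ_1` of a five-vector (the partition function of the free model). [folklore] -/
def val (q : ℝ) (Z : V5) : ℝ := q ^ 3 * Z.z0 + q ^ 2 * (Z.zab + Z.zac + Z.zbc) + q * Z.z1

/-- A Boolean as the real number `0` or `1`. [folklore] -/
def bR (x : Bool) : ℝ := if x then 1 else 0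

/-- The leaf letter of an attachment pattern. [folklore] -/
def leafB (q : ℝ) (x y z : Bool) : V5 := leaf q (bR x) (bR y) (bR z)

/-- The `q`-factor of a pattern: `q` if the leaf is unattached, `1` otherwise. [folklore] -/
def qfac (q : ℝ) (x y z : Bool) : ℝ := if x || y || z then 1 else q

/-- **A rigid leaf acts on basis vectors**: `M(leaf q x y z)(r·e_π) = (r·qfac)·e_{π.attach x y z}`. [folklore] -/
theorem conv_leafB_basis (q r : ℝ) (x y z : Bool) (π : P3) :
    conv (leafB q x y z) (V5.smul r (basisVec π)) = V5.smul (r * qfac q x y z) (basisVec (π.attach x y z)) := by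
  cases π <;> cases x <;> cases y <;> cases z <;>
    (ext <;> simp [conv, leafB, leaf, bR, qfac, V5.smul, basisVec, P3.attach, P3.joinAB, P3.joinAC, P3.joinBC, V5.total, mul_comm])

/-- The product of the first `i` rigid leaf letters applied to `e_{π₀}`. [folklore] -/
def zvecB (q : ℝ) (att : ℕ → Bool × Bool × Bool) (π₀ : P3) : ℕ → V5
  | 0 => basisVec π₀
  | i + 1 => conv (leafB q (att i).1 (att i).2.1 (att i).2.2) (zvecB q att π₀ i)

/-- The accumulated `q`-factor `q^{#unattached leaves < i}`. [folklore] -/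
def qpow (q : ℝ) (att : ℕ → Bool × Bool × Bool) : ℕ → ℝ
  | 0 => 1
  | i + 1 => qpow q att i * qfac q (att i).1 (att i).2.1 (att i).2.2

/-- **Rigid product = scaled basis vector**: `zvecB i = q^{#unattached} · e_{apexState i}`. [folklore] -/
theorem zvecB_eq (q : ℝ) (att : ℕ → Bool × Bool × Bool) (π₀ : P3) (i : ℕ) :
    zvecB q att π₀ i = V5.smul (qpow q att i) (basisVec (apexState att π₀ i)) := by
  induction i with
  | zero => ext <;> simp [zvecB, qpow, V5.smul, apexState]
  | succ i ih => rw [zvecB, ih, conv_leafB_basis]; rfl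

/-- `q^{#unattached}` as a power: `qpow i = q ^ (i − attached i)` (with `attached i ≤ i`). [folklore] -/
theorem attached_le (att : ℕ → Bool × Bool × Bool) (i : ℕ) : attached att i ≤ i := by
  induction i with
  | zero => simp [attached]
  | succ i ih => simp only [attached]; split_ifs <;> omega

/-- `qpow q att i = q ^ (i - attached att i)`. [folklore] -/
theorem qpow_eq (q : ℝ) (att : ℕ → Bool × Bool × Bool) (i : ℕ) : qpow q att i = q ^ (i - attached att i) := by
  induction i with
  | zero => simp [qpow, attached]
  | succ i ih =>
    have hle := attached_le att i
    simp only [qpow, attached, ih, qfac]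
    split_ifs with h
    · rw [mul_one]; congr 1; omega
    · rw [← pow_succ]; congr 1; omega

/-- The valuation of a scaled basis vector: `val (r·e_π) = r·q^{blocks π}`. [folklore] -/
theorem val_smul_basisVec (q r : ℝ) (π : P3) : val q (V5.smul r (basisVec π)) = r * q ^ π.blocks := by
  cases π <;> simp [val, V5.smul, basisVec, P3.blocks] <;> ring

/-- **Valuation of the rigid product**: `val (zvecB i) = q ^ (blocks π_i + (i − attached i))`. [folklore] -/
theorem val_zvecB (q : ℝ) (att : ℕ → Bool × Bool × Bool) (π₀ : P3) (i : ℕ) :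
    val q (zvecB q att π₀ i) = q ^ ((apexState att π₀ i).blocks + (i - attached att i)) := by
  rw [zvecB_eq, val_smul_basisVec, qpow_eq, pow_add, mul_comm]

end ThreeApex

end FK

end Summit.CriticalPhenomena.PercolationContinuityZ3.Theorems
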